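import Mathlib.LinearAlgebra.Dual.Lemmas
import Summits.Langlands.Langlands.Theorems.IrreducibilityBySelfDualityReciprocityUpToIrreducibilityRStringDefs
import Summits.Langlands.Langlands.Theorems.IrreducibilityBySelfDualityReciprocityUpToIrreducibilityRReducibleEulerPole
import HarnessLib

/-!
# Stub G2 `stub_finrank_homWD_eq_of_dual_probes` for line `Sketch`
# (crux stmt-Langlands-17925 `IrreducibilityBySelfDuality.ReciprocityUpToIrreducibilityR`,
# registered sub-goal toward stub S-17a-B, Henniart 2002 Thm 1.7 (a), Galois side)

**Freeing the `Hom`-dimension hypothesis from the contragredient and from the carrier `ℂ^r`.**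
The hypothesis of Henniart's Thm 1.7 (a) in invariant form reads
`dim Hom_WD(τ^∨, σ) = dim Hom_WD(τ^∨, σ')` for all indecomposable Frobenius-semisimple `τ` on
`Fin r → ℂ`, `0 < r < n`.  We deduce `dim Hom_WD(τ₁, σ) = dim Hom_WD(τ₁, σ')` for every
indecomposable Frobenius-semisimple `τ₁` on ANY finite-dimensional `W` with `0 < dim W < n`:

1. transport `τ₁^∨` (on `W^*`) along a linear isomorphism `W^* ≃ ℂ^r`, `r = dim W`, to a
   Weil–Deligne representation `τ ≅ τ₁^∨` on `Fin r → ℂ` (`(e ρ e⁻¹, e N e⁻¹)`);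
2. `τ` is Frobenius-semisimple (transpose of a semisimple operator) and indecomposable:
   indecomposability is an isomorphism invariant, and passes to the contragredient — if
   `τ₁^∨ = P ⊕ P'` with sub-Weil–Deligne representations `P, P'`, the co-annihilators
   `P^⊥, P'^⊥ ≤ W` are complementary sub-Weil–Deligne representations of `τ₁`
   (finite-dimensional duality: `dualCoannihilator` is an antitone lattice isomorphism);
3. `τ^∨ ≅ τ₁^∨∨ ≅ τ₁` (the contragredient is functorial on isomorphisms — transpose of the
   inverse — and `W ≃ W^{**}`, `Module.evalEquiv`, is an isomorphism `τ₁ ≅ τ₁^∨∨` since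
   `N^∨∨ = (-(-Nᵀ))ᵀ`);
4. `Hom_WD(·, σ)` turns isomorphisms into linear isomorphisms (`f ↦ f ∘ e`), so the dimensions
   agree.

Ref: Deligne, Antwerp II, LNM 349 (1973), §8.4; Tate, Corvallis 1979, (4.1.2)–(4.1.6);
Henniart, Bull. SMF 130 (2002), §1.7.  No definitions, no named facts.
-/

noncomputable section

set_option linter.dupNamespace false -- `Summit.Langlands.Langlands` is the mandated namespace

open Module
open Literature.NumberTheory.Automorphic Literature.NumberTheory.GaloisRepresentations
open Literature.NumberTheory.GaloisRepresentations.WeilGroup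
open Literature.NumberTheory.GaloisRepresentations.IsNonarchimedeanLocalField
open Summit.Langlands.Langlands.Theorems.ReciprocityRigidity

namespace Summit.Langlands.Langlands.Theorems.ReciprocityUpToIrreducibilityR

variable {F : Type} [Field F] [ValuativeRel F] [TopologicalSpace F] [IsNonarchimedeanLocalField F]

/-! ## Isomorphisms: pointwise inverses and transport of structure -/

section Equiv

variable {W : Type*} [AddCommGroup W] [Module ℂ W] {W' : Type*} [AddCommGroup W'] [Module ℂ W']
  {r : WeilDeligneRep F ℂ W} {r' : WeilDeligneRep F ℂ W'}

/-- The inverse of a linear isomorphism intertwining the Weil group actions intertwines them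
(pointwise). [folklore] -/
theorem linearEquiv_symm_ρ_apply (E : W ≃ₗ[ℂ] W') (hρ : ∀ (w : WeilGroup F) (x : W),
    E (r.ρ w x) = r'.ρ w (E x)) (w : WeilGroup F) (y : W') :
    E.symm (r'.ρ w y) = r.ρ w (E.symm y) := by
  apply E.injective
  rw [hρ, LinearEquiv.apply_symm_apply, LinearEquiv.apply_symm_apply]

/-- The inverse of a linear isomorphism intertwining the monodromy operators intertwines them
(pointwise). [folklore] -/
theorem linearEquiv_symm_N_apply (E : W ≃ₗ[ℂ] W') (hN : ∀ x : W, E (r.N x) = r'.N (E x))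
    (y : W') : E.symm (r'.N y) = r.N (E.symm y) := by
  apply E.injective
  rw [hN, LinearEquiv.apply_symm_apply, LinearEquiv.apply_symm_apply]

/-- **Indecomposability is an isomorphism invariant**: pull a decomposition of `r'` back along
the isomorphism (an order isomorphism of the lattices of subspaces). [folklore] -/
theorem isIndecomposable_of_equiv (e : r.Equiv r') (h : r.IsIndecomposable) :
    r'.IsIndecomposable := by
  haveI := h.1
  refine ⟨e.toLinearEquiv.injective.nontrivial, fun p p' hp hp' hc => ?_⟩
  have hsurj : Function.Surjective (e.toLinearEquiv : W →ₗ[ℂ] W') := e.toLinearEquiv.surjective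
  have hc' : IsCompl (p.comap (e.toLinearEquiv : W →ₗ[ℂ] W'))
      (p'.comap (e.toLinearEquiv : W →ₗ[ℂ] W')) :=
    (Submodule.orderIsoMapComap e.toLinearEquiv).symm.isCompl hc
  rcases h.2 _ _ (isSubrep_comap_of_equiv e hp) (isSubrep_comap_of_equiv e hp') hc' with h0 | h0
  · left
    rw [← Submodule.map_comap_eq_of_surjective hsurj p, h0, Submodule.map_bot]
  · right
    rw [← Submodule.map_comap_eq_of_surjective hsurj p', h0, Submodule.map_bot]

/-- **Transport of structure**: a Weil–Deligne representation `(ρ, N)` on `W` and a linear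
isomorphism `e : W ≃ X` give the isomorphic Weil–Deligne representation `(e ρ e⁻¹, e N e⁻¹)` on
`X`. [folklore] -/
theorem exists_isEquivalent_transport {X : Type*} [AddCommGroup X] [Module ℂ X]
    (r : WeilDeligneRep F ℂ W) (e : W ≃ₗ[ℂ] X) :
    ∃ r'' : WeilDeligneRep F ℂ X, r.IsEquivalent r'' := by
  let ρ' : Representation ℂ (WeilGroup F) X := e.conjRingEquiv.toMonoidHom.comp r.ρ
  have hρ' : ∀ w, ρ' w = (e : W →ₗ[ℂ] X) ∘ₗ r.ρ w ∘ₗ (e.symm : X →ₗ[ℂ] W) := fun w => rfl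
  have hc : WeilGroup.IsContinuousRep ρ' := by
    obtain ⟨U, hU, hUo, hρ⟩ := r.isContinuous
    refine ⟨U, hU, hUo, fun u hu => ?_⟩
    rw [hρ', hρ u hu]; ext; simp
  have hNil : IsNilpotent ((e : W →ₗ[ℂ] X) ∘ₗ r.N ∘ₗ (e.symm : X →ₗ[ℂ] W)) := by
    have h : (e : W →ₗ[ℂ] X) ∘ₗ r.N ∘ₗ (e.symm : X →ₗ[ℂ] W) = e.conjRingEquiv r.N := rfl
    rw [h]
    exact r.isNilpotent_N.map _
  let r'' : WeilDeligneRep F ℂ X :=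
    { ρ := ρ'
      isContinuous := hc
      N := (e : W →ₗ[ℂ] X) ∘ₗ r.N ∘ₗ (e.symm : X →ₗ[ℂ] W)
      isNilpotent_N := hNil
      conj_N := fun w => by
        rw [hρ']
        ext x
        simp [r.ρ_N_apply] }
  refine ⟨r'', ⟨{ toRepEquiv := Representation.Equiv.mk e fun w => ?_, comm_N := ?_ }⟩⟩
  · change (e : W →ₗ[ℂ] X) ∘ₗ r.ρ w = ρ' w ∘ₗ (e : W →ₗ[ℂ] X)
    rw [hρ']; ext; simp
  · change (e : W →ₗ[ℂ] X) ∘ₗ r.N =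
      ((e : W →ₗ[ℂ] X) ∘ₗ r.N ∘ₗ (e.symm : X →ₗ[ℂ] W)) ∘ₗ (e : W →ₗ[ℂ] X)
    ext; simp

end Equiv

/-! ## `Hom_WD(·, σ)` on isomorphic sources -/

section Hom

variable {W : Type*} [AddCommGroup W] [Module ℂ W] {W' : Type*} [AddCommGroup W'] [Module ℂ W']
  {V : Type*} [AddCommGroup V] [Module ℂ V]
  {τa : WeilDeligneRep F ℂ W} {τb : WeilDeligneRep F ℂ W'}

/-- Pre-composition with a linear isomorphism `E` intertwining `τ_a` and `τ_b` maps
`Hom_WD(τ_b, σ)` into `Hom_WD(τ_a, σ)`. [cite: Deligne1973Constantes, 8.5–8.6] -/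
theorem comp_mem_homWD_of_intertwining (E : W ≃ₗ[ℂ] W')
    (hρ : ∀ (w : WeilGroup F) (x : W), E (τa.ρ w x) = τb.ρ w (E x))
    (hN : ∀ x : W, E (τa.N x) = τb.N (E x)) {σ : WeilDeligneRep F ℂ V} {g : W' →ₗ[ℂ] V}
    (hg : g ∈ homWD τb σ) : g ∘ₗ (E : W →ₗ[ℂ] W') ∈ homWD τa σ := by
  refine ⟨fun w => LinearMap.ext fun x => ?_, LinearMap.ext fun x => ?_⟩
  · have h := congr($(hg.1 w) (E x))
    simp only [LinearMap.coe_comp, Function.comp_apply] at h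
    simp only [LinearMap.coe_comp, Function.comp_apply, LinearEquiv.coe_coe, hρ]
    exact h
  · have h := congr($(hg.2) (E x))
    simp only [LinearMap.coe_comp, Function.comp_apply] at h
    simp only [LinearMap.coe_comp, Function.comp_apply, LinearEquiv.coe_coe, hN]
    exact h

/-- Conversely, if `g ∘ E ∈ Hom_WD(τ_a, σ)` for an intertwining linear isomorphism `E` then
`g ∈ Hom_WD(τ_b, σ)`. [cite: Deligne1973Constantes, 8.5–8.6] -/
theorem mem_homWD_of_comp_mem_of_intertwining (E : W ≃ₗ[ℂ] W')
    (hρ : ∀ (w : WeilGroup F) (x : W), E (τa.ρ w x) = τb.ρ w (E x))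
    (hN : ∀ x : W, E (τa.N x) = τb.N (E x)) {σ : WeilDeligneRep F ℂ V} {g : W' →ₗ[ℂ] V}
    (hg : g ∘ₗ (E : W →ₗ[ℂ] W') ∈ homWD τa σ) : g ∈ homWD τb σ := by
  refine ⟨fun w => LinearMap.ext fun y => ?_, LinearMap.ext fun y => ?_⟩
  · obtain ⟨x, rfl⟩ := E.surjective y
    have h := congr($(hg.1 w) x)
    simp only [LinearMap.coe_comp, Function.comp_apply, LinearEquiv.coe_coe, hρ] at h
    simpa only [LinearMap.coe_comp, Function.comp_apply] using h
  · obtain ⟨x, rfl⟩ := E.surjective y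
    have h := congr($(hg.2) x)
    simp only [LinearMap.coe_comp, Function.comp_apply, LinearEquiv.coe_coe, hN] at h
    simpa only [LinearMap.coe_comp, Function.comp_apply] using h

/-- **`Hom_WD(·, σ)` respects isomorphisms of the source** (linear-isomorphism form): `f ↦ f ∘ E`
is a linear isomorphism `Hom_WD(τ_b, σ) ≃ Hom_WD(τ_a, σ)`, so the dimensions agree.
[cite: Deligne1973Constantes, 8.5–8.6] -/
theorem finrank_homWD_eq_of_intertwining (E : W ≃ₗ[ℂ] W')
    (hρ : ∀ (w : WeilGroup F) (x : W), E (τa.ρ w x) = τb.ρ w (E x))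
    (hN : ∀ x : W, E (τa.N x) = τb.N (E x)) (σ : WeilDeligneRep F ℂ V) :
    finrank ℂ (homWD τa σ) = finrank ℂ (homWD τb σ) := by
  let Φ : (W' →ₗ[ℂ] V) ≃ₗ[ℂ] (W →ₗ[ℂ] V) := E.symm.arrowCongr (LinearEquiv.refl ℂ V)
  have hΦ : ∀ g : W' →ₗ[ℂ] V, Φ g = g ∘ₗ (E : W →ₗ[ℂ] W') := fun g => by
    ext x; simp [Φ, LinearEquiv.arrowCongr_apply]
  have hcomap : (homWD τa σ).comap (Φ : (W' →ₗ[ℂ] V) →ₗ[ℂ] (W →ₗ[ℂ] V)) = homWD τb σ := by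
    ext g
    simp only [Submodule.mem_comap, LinearEquiv.coe_coe, hΦ]
    exact ⟨mem_homWD_of_comp_mem_of_intertwining E hρ hN, comp_mem_homWD_of_intertwining E hρ hN⟩
  have h := (Φ.ofSubmodule' (homWD τa σ)).finrank_eq
  rw [hcomap] at h
  exact h.symm

/-- **`Hom_WD(·, σ)` respects isomorphisms of the source**: `dim Hom_WD(τ_a, σ) = dim Hom_WD(τ_b, σ)`
for `τ_a ≅ τ_b`. [cite: Deligne1973Constantes, 8.5–8.6] -/
theorem finrank_homWD_eq_of_equiv (e : τa.Equiv τb) (σ : WeilDeligneRep F ℂ V) :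
    finrank ℂ (homWD τa σ) = finrank ℂ (homWD τb σ) :=
  finrank_homWD_eq_of_intertwining e.toLinearEquiv (eulerIso_ρ_apply e) (eulerIso_N_apply e) σ

end Hom

/-! ## The contragredient: functoriality, double dual, indecomposability -/

section Dual

variable (hmul : IsFrobPow.mul (F := F)) (huniq : IsFrobPow.unique (F := F))
variable {W : Type*} [AddCommGroup W] [Module ℂ W] {W' : Type*} [AddCommGroup W'] [Module ℂ W']

/-- **The contragredient is functorial on isomorphisms** (linear-isomorphism form): an
intertwining `E : W ≃ W'` induces the isomorphism `(E⁻¹)ᵀ : r^∨ ≅ r'^∨`.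
[cite: TateCorvallis1979, (4.1.6)] -/
theorem isEquivalent_dual_of_intertwining {r : WeilDeligneRep F ℂ W} {r' : WeilDeligneRep F ℂ W'}
    (E : W ≃ₗ[ℂ] W') (hρ : ∀ (w : WeilGroup F) (x : W), E (r.ρ w x) = r'.ρ w (E x))
    (hN : ∀ x : W, E (r.N x) = r'.N (E x)) :
    (r.dual hmul huniq).IsEquivalent (r'.dual hmul huniq) := by
  refine
    ⟨{ toRepEquiv := Representation.Equiv.mk E.symm.dualMap fun w => ?_
       comm_N := ?_ }⟩
  · ext φ y
    simp [WeilDeligneRep.dual_ρ, Representation.dual_apply, Module.Dual.transpose_apply,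
      linearEquiv_symm_ρ_apply E hρ]
  · change (E.symm.dualMap : Module.Dual ℂ W →ₗ[ℂ] Module.Dual ℂ W') ∘ₗ (r.dual hmul huniq).N =
      (r'.dual hmul huniq).N ∘ₗ (E.symm.dualMap : Module.Dual ℂ W →ₗ[ℂ] Module.Dual ℂ W')
    ext φ y
    simp [WeilDeligneRep.dual_N, linearEquiv_symm_N_apply E hN]

/-- **The contragredient is functorial on isomorphisms**: `r ≅ r'` gives `r^∨ ≅ r'^∨`.
[cite: TateCorvallis1979, (4.1.6)] -/
theorem isEquivalent_dual_of_equiv {r : WeilDeligneRep F ℂ W} {r' : WeilDeligneRep F ℂ W'}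
    (e : r.Equiv r') : (r.dual hmul huniq).IsEquivalent (r'.dual hmul huniq) :=
  isEquivalent_dual_of_intertwining hmul huniq e.toLinearEquiv (eulerIso_ρ_apply e)
    (eulerIso_N_apply e)

/-- **The double contragredient**: `W ≃ W^{**}` (`Module.evalEquiv`) is an isomorphism
`r ≅ r^∨∨` (`ρ^∨∨(w) = ((ρ(w⁻¹)⁻¹)ᵀ)ᵀ`-compatible, `N^∨∨ = (-(-Nᵀ))ᵀ`).
[cite: TateCorvallis1979, (4.1.6)] -/
theorem isEquivalent_dual_dual [FiniteDimensional ℂ W] (r : WeilDeligneRep F ℂ W) :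
    r.IsEquivalent ((r.dual hmul huniq).dual hmul huniq) := by
  refine
    ⟨{ toRepEquiv := Representation.Equiv.mk (Module.evalEquiv ℂ W) fun w => ?_
       comm_N := ?_ }⟩
  · ext x φ
    simp [WeilDeligneRep.dual_ρ, Representation.dual_apply, Module.Dual.transpose_apply]
  · change (Module.evalEquiv ℂ W : W →ₗ[ℂ] Module.Dual ℂ (Module.Dual ℂ W)) ∘ₗ r.N =
      ((r.dual hmul huniq).dual hmul huniq).N ∘ₗ
        (Module.evalEquiv ℂ W : W →ₗ[ℂ] Module.Dual ℂ (Module.Dual ℂ W))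
    ext x φ
    simp [WeilDeligneRep.dual_N]

/-- The co-annihilator `Q^⊥ ≤ W` of a sub-Weil–Deligne representation `Q ≤ W^*` of the
contragredient is a sub-Weil–Deligne representation. [cite: TateCorvallis1979, (4.1.6)] -/
theorem isSubrep_dualCoannihilator (r : WeilDeligneRep F ℂ W) {Q : Submodule ℂ (Module.Dual ℂ W)}
    (hQ : (r.dual hmul huniq).IsSubrep Q) : r.IsSubrep Q.dualCoannihilator := by
  refine ⟨fun w x hx => ?_, fun x hx => ?_⟩
  · simp only [Submodule.mem_comap, Submodule.mem_dualCoannihilator] at hx ⊢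
    intro φ hφ
    simpa [Module.Dual.transpose_apply] using hx _ (hQ.1 w⁻¹ hφ)
  · simp only [Submodule.mem_comap, Submodule.mem_dualCoannihilator] at hx ⊢
    intro φ hφ
    simpa using hx _ (hQ.2 hφ)

/-- **The contragredient of an indecomposable Weil–Deligne representation is indecomposable**
(finite-dimensional duality: a decomposition `r^∨ = P ⊕ P'` into sub-Weil–Deligne
representations gives the decomposition `r = P^⊥ ⊕ P'^⊥`). [cite: TateCorvallis1979, (4.1.6)] -/
theorem isIndecomposable_dual [FiniteDimensional ℂ W] (r : WeilDeligneRep F ℂ W)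
    (h : r.IsIndecomposable) : (r.dual hmul huniq).IsIndecomposable := by
  haveI := h.1
  refine ⟨inferInstance, fun P P' hP hP' hc => ?_⟩
  have hc' : IsCompl P.dualCoannihilator P'.dualCoannihilator :=
    (Subspace.orderIsoFiniteDimensional (K := ℂ) (V := W)).symm.isCompl hc.dual
  rcases h.2 _ _ (isSubrep_dualCoannihilator hmul huniq r hP)
    (isSubrep_dualCoannihilator hmul huniq r hP') hc' with h0 | h0
  · right
    have hP1 : P = ⊤ := by
      rw [← Subspace.dualCoannihilator_dualAnnihilator_eq (W := P), h0,
        Submodule.dualAnnihilator_bot]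
    rw [hP1] at hc
    exact eq_bot_of_top_isCompl hc
  · left
    have hP1 : P' = ⊤ := by
      rw [← Subspace.dualCoannihilator_dualAnnihilator_eq (W := P'), h0,
        Submodule.dualAnnihilator_bot]
    rw [hP1] at hc
    exact eq_bot_of_isCompl_top hc

end Dual

/-- **Stub G2 (toward Henniart 2002, Thm 1.7 (a)): the `Hom`-dimension hypothesis for dual probes
on `ℂ^r` gives it for arbitrary indecomposable Frobenius-semisimple probes.**  Given `τ₁` on `W`,
`0 < dim W = r < n`, transport `τ₁^∨` to `τ` on `Fin r → ℂ` (Frobenius-semisimple, indecomposable),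
apply the hypothesis to `τ`, and use `τ^∨ ≅ τ₁^∨∨ ≅ τ₁` together with the invariance of
`dim Hom_WD(·, σ)` under isomorphisms of the source. [cite: HenniartBSMF2002, Thm 1.7 (a)] -/
theorem stub_finrank_homWD_eq_of_dual_probes : ∀ (F : Type) [Field F] [ValuativeRel F] [TopologicalSpace F] [IsNonarchimedeanLocalField F] (hmul : @IsFrobPow.mul F _ _ _ _) (huniq : @IsFrobPow.unique F _ _ _ _) (V : Type) [AddCommGroup V] [Module ℂ V] [FiniteDimensional ℂ V] (V' : Type) [AddCommGroup V'] [Module ℂ V'] [FiniteDimensional ℂ V'] (σ : WeilDeligneRep F ℂ V) (σ' : WeilDeligneRep F ℂ V') (n : ℕ), (∀ (r : ℕ), 0 < r → r < n → ∀ τ : WeilDeligneRep F ℂ (Fin r → ℂ), τ.IsFrobSemisimple → τ.IsIndecomposable → Module.finrank ℂ ↥(homWD (τ.dual hmul huniq) σ) = Module.finrank ℂ ↥(homWD (τ.dual hmul huniq) σ')) → ∀ (W : Type) [AddCommGroup W] [Module ℂ W] [FiniteDimensional ℂ W] (τ₁ : WeilDeligneRep F ℂ W), τ₁.IsFrobSemisimple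 → τ₁.IsIndecomposable → 0 < Module.finrank ℂ W → Module.finrank ℂ W < n → Module.finrank ℂ ↥(homWD τ₁ σ) = Module.finrank ℂ ↥(homWD τ₁ σ') := by
  intro F _ _ _ _ hmul huniq V _ _ _ V' _ _ _ σ σ' n hyp W _ _ _ τ₁ hfs hind hpos hlt
  -- (1) transport `τ₁^∨` to `Fin r → ℂ`, `r = dim W`
  let e : Module.Dual ℂ W ≃ₗ[ℂ] (Fin (finrank ℂ W) → ℂ) :=
    LinearEquiv.ofFinrankEq _ _ (by rw [Subspace.dual_finrank_eq, Module.finrank_fin_fun])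
  obtain ⟨τ, ⟨eτ⟩⟩ := exists_isEquivalent_transport (τ₁.dual hmul huniq) e
  -- (2) `τ` is Frobenius-semisimple and indecomposable
  have hτfs : τ.IsFrobSemisimple :=
    isFrobSemisimple_of_equiv eτ (isFrobSemisimple_dual hmul huniq τ₁ hfs)
  have hτind : τ.IsIndecomposable :=
    isIndecomposable_of_equiv eτ (isIndecomposable_dual hmul huniq τ₁ hind)
  have key := hyp (finrank ℂ W) hpos hlt τ hτfs hτind
  -- (3) `τ^∨ ≅ τ₁^∨∨ ≅ τ₁` and (4) invariance of `dim Hom_WD(·, σ)`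
  obtain ⟨e₁⟩ := isEquivalent_dual_of_equiv hmul huniq eτ.symm
  obtain ⟨e₂⟩ := isEquivalent_dual_dual hmul huniq τ₁
  rw [finrank_homWD_eq_of_equiv e₂ σ, finrank_homWD_eq_of_equiv e₂ σ',
    ← finrank_homWD_eq_of_equiv e₁ σ, ← finrank_homWD_eq_of_equiv e₁ σ']
  exact key

end Summit.Langlands.Langlands.Theorems.ReciprocityUpToIrreducibilityR

end
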